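import Summits.Langlands.Langlands.Theses.EisensteinDegreeShift

/-!
# RATTACK — `EisensteinDegreeShift.SectorComplement` (stmt-Langlands-18372): crux-attack at birth, work file

Seat refuter-rattack-stmt-Langlands-18372-0 (ONE cycle, 2026-08-17), route `route-Langlands-EisensteinDegreeShift`
rev 0. Item: `SectorComplement : Prop := BorelFLReciprocity → _root_.Langlands` (crux rank 9, the route's
declared RESIDUAL junction: "THE REST OF THE SUMMIT along this line … implied by the summit … never staffed").
This directory `Cruxes/SectorComplement/` is SHARED by ≥ 10 homonymous junction items; everything of this
seat carries the prefix `eds_` / suffix `_EisensteinDegreeShift` and lives in namespace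
`…Cruxes.SectorComplement.RattackEDS` (the Negative-lane proposal copy, p169529 →
`Theorems/SectorComplement/Negative/EisensteinDegreeShiftSectorComplementPosition.lean`, restates §1–§2 under
`Summit.Langlands.Langlands.Theorems` with `eisensteinDegreeShift_` prefixes and WITHOUT the positively-concluded
identities of §2, which may only live here).

## Findings (all kernel-checked below; `lean check` rc 0, 0 sorry, axioms ⊆ {propext, Classical.choice, Quot.sound})

* §0 A1 / readback: the decl elaborates (W.lean rc 0, one sorry); its body is literally
  `BorelFLReciprocity → _root_.Langlands` (`Iff.rfl`) — an implication between two CLOSED propositions: no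
  binders, coercions, junk operators, quantifier order or normalisation of its own to attack (those live in
  the target X = `BorelFLReciprocity`, item stmt-Langlands-18368, not served to this seat). 3a: `simp`,
  `decide`, `aesop`, `exact?` all fail on the unfolded goal `BorelFLReciprocity ⊢ Langlands` (T.lean).
* §1 position: `¬ C ↔ X ∧ ¬ Langlands` (`eds_not_sectorComplement_iff`) — the item is refutable only by
  proving the open sector theorem X AND refuting the audited summit; S → C is `fun h _ ↦ h`.
* §2 containment, NEW for this route: `Langlands → X` (`eds_target_of_langlands`): the sector is inside the
  summit AS TYPED — direction (B) at rank `n` (`0 < n` from `2 ≤ n`), `ℓ = p`, `𝓡` from the summit's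
  non-vacuity conjunct, crystalline-for-the-pinned-datum ⇒ de Rham for `𝓡.pst p v hv`
  (`ReciprocityData.pst` is `fontainePstAdicCompletion` by `rfl`; `IsCrystallineFramed.isDeRhamFramed`), the
  conclusion of X is the first conjunct of `Corresponds`. Hence the EXACT bookkeeping identity
  `Langlands ↔ X ∧ C` (`eds_langlands_iff_target_and_sectorComplement`): no typing drift between X's
  conclusion and (B); X cannot be "false for a typing reason" unless the summit is; and the CM /
  `p`-unramified / residually-Borel / labelled-Fontaine–Laffaille hypotheses of X are pure RESTRICTIONS
  (discarded in the containment proof).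
* §3 restates-summit probes: S → C trivially; `(C → S) ↔ X` (`eds_sectorComplement_imp_langlands_iff_target`)
  — the junction is "the summit in a costume" EXACTLY iff the open sector theorem is provable, not by any
  typing accident. C with its only hypothesis dropped is the summit (`SectorComplementWithoutTarget_EisensteinDegreeShift`).
  Under the route's three content items (S1 `EisensteinSteinbergSeed`, S2 `EisensteinSeededLifting`, S3
  `SolubleDescentGLn`, all OPEN) `C ↔ Langlands` (`eds_sectorComplement_iff_langlands_of_cruxes`, `→` = the
  route's sorry-free `closes`).
* §4 vacuity of X (the one way C could collapse onto S, cf. `RATTACK_RepeatedRootSocle.md` where the sector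
  WAS vacuous): NOT vacuous by any cheap argument. Hypotheses of X read back one by one: `IsCMField K`,
  `2 ≤ n < p`, `p` unramified (`∀ v ∋ p, ¬ v² ∣ (p)`), `O = 𝒪_{ℚ̄_p}`, `hcpt` (a theorem:
  `GLnAdelicStructureProofs`), `ι` (exists: `PadicAlgClEquivComplex`), `ρ` continuous irreducible a.e.
  unramified with a residually upper-triangular integral model IN THE SAME FRAME (`HasUpperTriangularIntegralModel`
  = `GL_n(O) → GL_n(ℚ̄_p)` maps `ρ₀` to `ρ` ∧ `(ρ₀ g)ᵢⱼ ∈ 𝔪` for `j < i` — residual, not integral, upper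
  triangularity, so compatible with irreducibility; any residually Borel `ρ` can be re-framed so), crystalline at
  `v ∣ p` for the pinned datum with, for every `τ : K_v →ₐ[ℚ_p] ℚ̄_p`, `n` distinct labelled weights of spread
  `≤ p − 2` (integer side satisfiable since `n − 1 ≤ p − 2`, `eds_weightClause_satisfiable`). Paper witness
  (planner's falsifier (2), checked on paper here): `ρ = ρ_{E,5}|Γ_{ℚ(i)}`, `E = 11a1` (rational 5-isogeny ⇒
  residually Borel; non-CM ⇒ irreducible on the index-2 subgroup; good reduction at 5 ⇒ crystalline, weights
  {0, 1} per label, spread 1 ≤ 3; 5 splits in `ℚ(i)`; conclusion true by quadratic base change of the level-11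
  newform). No Lean witness is constructible (no crystalline irreducible `ρ` with distinct weights exists in the
  tree: `isCrystallineFramed_of_isLocallyUnramified` gives weights all 0, cyclotomic sums are reducible), and
  vacuity is not PROVABLE either short of `¬ FontaineDatumExists` (the pinned datum is Hilbert-ε over
  `IsFontaineDatum`; tree-wide AMBER-4 pin shared with the summit) — so `C ↔ S` is not derivable.
* §5 junk / degenerate instances of C: none exist (no binders). Emptiness of the label type `K_v →ₐ[ℚ_p] ℚ̄_p`
  for a junk datum would only STRENGTHEN X (weight clause vacuous ⇒ irregular `ρ` included) and X would still
  be inside the summit by §2 — harmless for C.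
* VERDICT: survives; irrefutable short of refuting the audited summit; honest residual junction
  (`Langlands ↔ X ∧ C`). No kill, no misstatement.
-/

set_option linter.dupNamespace false

namespace Summit.Langlands.Langlands.Cruxes.SectorComplement.RattackEDS

open Summit.Langlands.Langlands.Theses.EisensteinDegreeShift

/-! ## §1 Position -/

/-- S → C: the junction is implied by the summit (discard the sector hypothesis). [folklore] -/
theorem eds_sectorComplement_of_langlands : _root_.Langlands → SectorComplement :=
  fun h _ ↦ h

/-- Exact content of a refutation: `¬ C ↔ X ∧ ¬ Langlands`. [folklore] -/
theorem eds_not_sectorComplement_iff :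
    ¬ SectorComplement ↔ BorelFLReciprocity ∧ ¬ _root_.Langlands :=
  Classical.not_imp

/-- `¬ C → ¬ Langlands`: the item is never stronger than the summit. [folklore] -/
theorem eds_not_langlands_of_not_sectorComplement (h : ¬ SectorComplement) : ¬ _root_.Langlands :=
  (eds_not_sectorComplement_iff.mp h).2

/-! ## §2 Containment of the sector in the summit (work-file only: concludes the target positively) -/

/-- **The sector theorem is inside the summit as typed**: `Langlands → BorelFLReciprocity` — direction (B)
at rank `n`, `ℓ = p`, reciprocity data from `Nonempty (ReciprocityData K)`, crystalline for the pinned datum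
⇒ de Rham for `𝓡.pst` (`IsCrystallineFramed.isDeRhamFramed`, `ReciprocityData.pst = fontainePstAdicCompletion`
by `rfl`), Satake a.e. = `Corresponds.1`. [folklore] -/
theorem eds_target_of_langlands (hL : _root_.Langlands) : BorelFLReciprocity := by
  intro K _ _ _hK n hn p _ _hp _hur O _hO hcpt ι ρ ρ₀ hirr hae _hut hFL
  obtain ⟨⟨𝓡⟩, h⟩ := hL K
  have hB : Summit.Langlands.GaloisToAutomorphic n 𝓡 hcpt := (h 𝓡 n (by omega) hcpt).2
  have hgeo : Summit.Langlands.IsGeometricFramed 𝓡 ρ :=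
    ⟨hae, fun v hv ↦ (hFL v hv).1.isDeRhamFramed⟩
  obtain ⟨π, hLalg, hcorr⟩ := hB p ι ρ hirr hgeo
  exact ⟨π, hLalg, hcorr.1⟩

/-- **Exact bookkeeping identity**: `Langlands ↔ X ∧ C` — the target and its declared complement
partition the summit with no typing drift. [folklore] -/
theorem eds_langlands_iff_target_and_sectorComplement :
    _root_.Langlands ↔ BorelFLReciprocity ∧ SectorComplement :=
  ⟨fun h ↦ ⟨eds_target_of_langlands h, fun _ ↦ h⟩, fun h ↦ h.2 h.1⟩

/-- `¬ X → C ∧ ¬ Langlands`: a counterexample to Fontaine–Mazur in the sector PROVES this crux (ex falso)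
and refutes the summit. [folklore] -/
theorem eds_sectorComplement_of_not_target (hX : ¬ BorelFLReciprocity) :
    SectorComplement ∧ ¬ _root_.Langlands :=
  ⟨fun h ↦ (hX h).elim, fun hL ↦ hX (eds_target_of_langlands hL)⟩

/-! ## §3 Restates-summit probes and load-bearing analysis -/

/-- `SectorComplement` with its only hypothesis dropped is the summit itself (the protocol's
`_false_without_target` lemma would be `¬ Langlands` and is deliberately not stated). [folklore] -/
def SectorComplementWithoutTarget_EisensteinDegreeShift : Prop := _root_.Langlands

/-- Dropping the hypothesis costs exactly the target: `C-without-X ↔ X ∧ C`. [folklore] -/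
theorem eds_sectorComplementWithoutTarget_iff :
    SectorComplementWithoutTarget_EisensteinDegreeShift ↔ BorelFLReciprocity ∧ SectorComplement :=
  eds_langlands_iff_target_and_sectorComplement

/-- **Restates-summit probe `C → S`, settled**: `(SectorComplement → Langlands) ↔ BorelFLReciprocity`.
The junction is the summit in a costume exactly iff the open sector theorem holds. [folklore] -/
theorem eds_sectorComplement_imp_langlands_iff_target :
    (SectorComplement → _root_.Langlands) ↔ BorelFLReciprocity := by
  constructor
  · intro h
    by_contra hX
    exact hX (eds_target_of_langlands (h fun x ↦ (hX x).elim))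
  · intro hX hC
    exact hC hX

/-- Under the target, `C ↔ Langlands`. [folklore] -/
theorem eds_sectorComplement_iff_langlands_of_target (hX : BorelFLReciprocity) :
    SectorComplement ↔ _root_.Langlands :=
  ⟨fun hC ↦ hC hX, fun h _ ↦ h⟩

/-- Under the route's three content items (S1, S2, S3 — all open), `C ↔ Langlands` (`→` is the route's
sorry-free `closes`): once the route's own cruxes land, this item IS the summit. [folklore] -/
theorem eds_sectorComplement_iff_langlands_of_cruxes
    (h₁ : EisensteinSteinbergSeed) (h₂ : EisensteinSeededLifting) (h₃ : SolubleDescentGLn) :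
    SectorComplement ↔ _root_.Langlands :=
  ⟨fun hC ↦ closes h₁ h₂ h₃ hC, fun h _ ↦ h⟩

/-- Truth table: `C ↔ ¬ X ∨ Langlands`. [folklore] -/
theorem eds_sectorComplement_iff_not_or :
    SectorComplement ↔ ¬ BorelFLReciprocity ∨ _root_.Langlands :=
  imp_iff_not_or

/-! ## §4 Vacuity of X — the integer side of the labelled-weight clause is satisfiable -/

/-- The weight clause of X ("`n` distinct labelled weights, card `n`, pairwise spread `≤ p − 2`") is
satisfiable as a clause on multisets whenever `n < p` (witness `{0, 1, …, n − 1}`); shown at the extreme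
admissible corner `n = 2, p = 3` and at `n = 4, p = 5` by `decide`. (The Galois side — an irreducible
crystalline `ρ` realising it — has the paper witness `ρ_{E,5}|Γ_{ℚ(i)}`, `E = 11a1`, and no Lean
construction.) [folklore] -/
theorem eds_weightClause_satisfiable :
    (let M : Multiset ℤ := {0, 1}; M.Nodup ∧ Multiset.card M = 2 ∧ ∀ a ∈ M, ∀ b ∈ M, a - b ≤ (3 : ℤ) - 2) ∧
    (let M : Multiset ℤ := {0, 1, 2, 3}; M.Nodup ∧ Multiset.card M = 4 ∧ ∀ a ∈ M, ∀ b ∈ M, a - b ≤ (5 : ℤ) - 2) := by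
  decide

end Summit.Langlands.Langlands.Cruxes.SectorComplement.RattackEDS
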